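import Summits.QuantumFields.YangMills.Theorems.F4SubCurvatureDoorFibreDichotomyInvariantMoments
import Summits.QuantumFields.YangMills.Theorems.F4SubCurvatureDoorFibreDichotomyShellKernelBounds
import Summits.QuantumFields.YangMills.Theorems.F4SubCurvatureDoorRationalToGeneralMirrorPatching
import Summits.QuantumFields.YangMills.Theorems.F4SubCurvatureDoorRationalToGeneralRadialODEDichotomy
import Mathlib
import HarnessLib

/-!
# LINE g21-B «fibre dichotomy» (⟨stmt-QuantumFields-23125⟩ `F4SubCurvatureDoor.RationalToGeneral`) — registered stub B4
# `stub_singleShellDichotomy : SingleShellDichotomy`, BY NAME AND SIGNATURE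

Skeleton `Cruxes/RationalToGeneral/Lines/fibre_dichotomy.lean` (:149–152, :173), stub plan `Lines/fibre_dichotomy_stubplans.md`.  The Prop
`SingleShellDichotomy` is restated CHARACTER-IDENTICALLY (vocabulary: `lfEval`, `SymmetricLF` = the verbatim copies in ns
`…F4SubCurvatureDoorFibreDichotomyAxis`; `IsShellMeasure` = the verbatim copy in ns `…F4SubCurvatureDoorShellLFAnalytic`; `E3`, `E4`, `timeSpace`
from `…LaplaceFourierRegistered` — the same constants as in the landed rung R-B4e `MirrorPatching`) and PROVED:

`stub_singleShellDichotomy : SingleShellDichotomy` — a positive, Laplace-integrable, forward-cone, single-shell measure whose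
Laplace–Fourier evaluation is `W(F₄)`-symmetric is EITHER radial off the mirror OR has axis growth `t⁸ L_ν(t) ≥ c > 0` for small `t`.

ASSEMBLY (all inputs are tree theorems): `s < 0` ⇒ `ν = 0` (radial).  Else let `Kp` be the patch of R-B4e ✓`mirrorPatching_holds`
(`C²` off `0`, `D₄`-invariant, `= lfEval ν` off the mirror, `Δ Kp = s Kp`).  If every harmonic moment `∫_{S³} Y(α) Kp(rα) dσ`
(`Y` harmonic homogeneous of degree `≥ 1`) vanishes, `Kp(r·)` is constant on spheres (✓`const_on_sphere_of_orthogonal_harmonics`, H7) ⇒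
alternative 1.  Otherwise some `Y` of degree `L` has a non-zero moment `g`; `L ≥ 6` by ✓`harmonicMoment_eq_zero_of_invariant` (H6, fed by R-B4b
✓`invariantHarmonicGap_holds`); `g` solves `g'' + 3g'/r − (L(L+2)/r² + s) g = 0` (✓`radialODE_of_helmholtz_offOrigin`, H3) and is bounded on
`[1, ∞)` (✓`moment_bounded`, H4), so R-B4a ✓`radialODEDichotomy_holds` gives `|g(r)| ≥ c r^{−L−2} ≥ c r⁻⁸` near `0`, while
`|g(r)| ≤ (∫|Y|) L_ν(r/√2)` (✓`moment_le_axis`, H8: R-B4c/R-B4d) ⇒ `t⁸ L_ν(t) ≥ c/(16 ∫|Y|)` for `t < min(r₀,1)/√2` ⇒ alternative 2.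

Mathlib + tree only; no `sorry`; standard axioms.  HONEST LABEL: this closes the registered stub B4 of the OPEN line g21-B only; B5
`stub_fibreReduction`, S1 `stub_forwardConeSupport` (XL), S2 `stub_shellSeparation`, the crux ⟨23125⟩, its parent ⟨23035⟩, rung R2d and the
Yang–Mills mass gap remain OPEN; no summit is proved by a line.  Seat `ym-line-frs-p2` g16 (cell ym-idea-3, free hands).
-/

noncomputable section

open MeasureTheory MeasureTheory.Measure Set Function Filter Topology Metric Module InnerProductSpace
open scoped RealInnerProductSpace Laplacian BigOperators

namespace Summit.QuantumFields.YangMills.Theorems.F4SubCurvatureDoorSingleShellDichotomyRegistered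

open Literature.Analysis.Calculus.MvPoly (toFun lap)
open Summit.QuantumFields.YangMills.Theorems.F4SubCurvatureDoorLaplaceFourierRegistered (E4 E3 timeSpace)
open Summit.QuantumFields.YangMills.Theorems.F4SubCurvatureDoorFibreDichotomyAxis (spacePart lfEval IsD4Isometry SymmetricLF)
open Summit.QuantumFields.YangMills.Theorems.F4SubCurvatureDoorShellLFAnalytic (massSq IsShellMeasure)
open Summit.QuantumFields.YangMills.Theorems.F4SubCurvatureDoorMirrorPatchingRegistered (mirrorPatching_holds)
open Summit.QuantumFields.YangMills.Theorems.F4SubCurvatureDoorRadialODEDichotomyRegistered (radialODEDichotomy_holds)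
open Summit.QuantumFields.YangMills.Theorems.F4SubCurvatureDoorHarmonicMomentODE (laplacian_eq_sum_iteratedFDeriv_single
  radialODE_of_helmholtz_offOrigin const_on_sphere_of_orthogonal_harmonics harmonicMoment_eq_zero_of_invariant eq_zero_of_neg_mass
  lfEval_zero_measure continuousOn_of_contDiffAt moment_le_axis moment_bounded axis_nonneg)

/-! ## The registered text (verbatim from `Lines/fibre_dichotomy.lean`) -/

/-- Stub B4 «SINGLE-SHELL DICHOTOMY» (M–L; THE NEW LEVER): a positive, Laplace-integrable, forward-cone, single-shell measure whose
Laplace–Fourier evaluation is `W(F₄)`-symmetric is EITHER radial (off the time-zero mirror) OR has axis growth `t⁸ · L_ν(t) ≥ c > 0` for all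
small `t`.  Content: frame patching (`C^∞` off `0`), `(Δ − s)K̃ = 0`, harmonic projections solve `g'' + (3/r)g' − (L(L+2)/r² + s)g = 0`, bounded at
`∞` ⇒ multiple of the decaying solution `φ_{L,s} > 0`, `φ_{L,s}(r) r^{L+2} → c_L > 0`; RP two-point domination `|K̃(x)| ≤ L_ν(‖x‖/√2)`;
`W(F₄)`-invariant harmonics live in degrees `0, 6, 8, 12, …` only.  [Widder1941 Ch. VI; AxlerBourdonRamey2001 Ch. 5; GlimmJaffeQP1987 §6.2;
OsterwalderSchraderCMP1973 (RP Cauchy–Schwarz)]  WHY IT MIGHT FAIL: it should not — the one place to watch is the `s = 0` fibre (null cone +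
a possible atom at the origin: constants are radial, massless components have `φ_{L,0} = r^{−L−2}`). -/
def SingleShellDichotomy : Prop :=
  ∀ (ν : Measure (ℝ × E3)) (s : ℝ), IsShellMeasure ν s → SymmetricLF ν →
    (∃ g₀ : ℝ → ℝ, ∀ x : E4, x 0 ≠ 0 → lfEval ν x = g₀ (‖x‖ ^ 2)) ∨
    (∃ c : ℝ, 0 < c ∧ ∃ t₀ : ℝ, 0 < t₀ ∧ ∀ t : ℝ, 0 < t → t < t₀ → c ≤ t ^ 8 * lfEval ν (timeSpace t 0))

/-! ## The proof -/

/-- **REGISTERED STUB B4 `stub_singleShellDichotomy` OF LINE g21-B, BY NAME AND SIGNATURE: `SingleShellDichotomy` holds.** -/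
theorem stub_singleShellDichotomy : SingleShellDichotomy := by
  intro ν s hshell hsym
  -- negative mass²: the measure vanishes, its evaluation is the radial function `0`
  by_cases hs : s < 0
  · refine Or.inl ⟨fun _ => 0, fun x _ => ?_⟩
    rw [eq_zero_of_neg_mass hshell hs, lfEval_zero_measure]
  have hs0 : 0 ≤ s := not_lt.1 hs
  -- the patched kernel of R-B4e
  obtain ⟨Kp, hC2, hinv, heq, hhelm⟩ := mirrorPatching_holds ν s hshell hsym
  have hpde : ∀ x : E4, x ≠ 0 → (Δ Kp) x = s * Kp x := fun x hx => by
    rw [laplacian_eq_sum_iteratedFDeriv_single]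
    exact hhelm x hx
  have hcont : ContinuousOn Kp {0}ᶜ := continuousOn_of_contDiffAt hC2
  by_cases hA : ∀ (L : ℕ) (P : MvPolynomial (Fin 4) ℝ), 1 ≤ L → P.IsHomogeneous L → lap P = 0 →
      ∀ r : ℝ, 0 < r → ∫ α, toFun P (α : E4) * Kp (r • (α : E4)) ∂(volume : Measure E4).toSphere = 0
  · -- ALTERNATIVE 1: every harmonic moment vanishes ⇒ `Kp` is constant on spheres ⇒ radial off the mirror
    left
    set e : E4 := EuclideanSpace.single 0 (1 : ℝ) with he
    have he1 : ‖e‖ = 1 := by simp [he, PiLp.norm_single]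
    refine ⟨fun v => Kp (Real.sqrt v • e), fun x hx => ?_⟩
    have hx0 : x ≠ 0 := fun h => hx (by rw [h]; rfl)
    have hnx : 0 < ‖x‖ := norm_pos_iff.2 hx0
    have hsm : Continuous (fun y : E4 => ‖x‖ • y) := continuous_const_smul ‖x‖
    have hf : ContinuousOn (fun y : E4 => Kp (‖x‖ • y)) {0}ᶜ := by
      refine hcont.comp hsm.continuousOn fun y hy => ?_
      simp only [mem_compl_iff, mem_singleton_iff, smul_eq_zero, not_or] at hy ⊢
      exact ⟨hnx.ne', hy⟩
    have hconst := const_on_sphere_of_orthogonal_harmonics hf (fun L P hL hP hh => hA L P hL hP hh ‖x‖ hnx)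
    have h1 := hconst (‖x‖⁻¹ • x) e (by rw [norm_smul, norm_inv, norm_norm, inv_mul_cancel₀ hnx.ne']) he1
    simp only [smul_smul, mul_inv_cancel₀ hnx.ne', one_smul] at h1
    rw [← heq x hx, h1]
    show Kp (‖x‖ • e) = Kp (Real.sqrt (‖x‖ ^ 2) • e)
    rw [Real.sqrt_sq hnx.le]
  · -- ALTERNATIVE 2: a non-vanishing harmonic moment of degree `L`; `L ≥ 6`; growth of the axis function
    right
    push Not at hA
    obtain ⟨L, P, hL1, hP, hharm, r₁, hr₁, hne⟩ := hA
    have hL6 : 6 ≤ L := by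
      by_contra hlt
      exact hne (harmonicMoment_eq_zero_of_invariant hcont hinv hL1 (by omega) hP hharm hr₁)
    -- the moment, its derivatives, and the radial ODE (H3)
    set g : ℝ → ℝ := fun r => ∫ α, toFun P (α : E4) * Kp (r • (α : E4)) ∂(volume : Measure E4).toSphere with hg
    set dg : ℝ → ℝ := fun r => ∫ α, toFun P (α : E4) * fderiv ℝ Kp (r • (α : E4)) (α : E4) ∂(volume : Measure E4).toSphere with hdg
    set ddg : ℝ → ℝ := fun r => ∫ α, toFun P (α : E4) * fderiv ℝ (fderiv ℝ Kp) (r • (α : E4)) (α : E4) (α : E4)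
      ∂(volume : Measure E4).toSphere with hddg
    have hode := radialODE_of_helmholtz_offOrigin hC2 hpde hP hharm (g := g) (dg := dg) (ddg := ddg)
      (fun r _ => rfl) (fun r _ => rfl) (fun r _ => rfl)
    have hbdd : ∃ B : ℝ, ∀ r : ℝ, 1 ≤ r → |g r| ≤ B := moment_bounded hshell hinv heq P
    -- R-B4a: `g ≡ 0` (impossible at `r₁`) or `r^{L+2} |g r| ≥ c` near `0`
    rcases radialODEDichotomy_holds L s hL1 hs0 g dg ddg (fun r hr => (hode r hr).1) (fun r hr => (hode r hr).2) hbdd with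
      hzero | ⟨c, hc, r₀, hr₀, hlow⟩
    · exact absurd (hzero r₁ hr₁) hne
    · -- transfer to the axis through `|g r| ≤ (∫|Y|) · L_ν(r/√2)` (H8)
      set CP : ℝ := ∫ α, |toFun P (α : E4)| ∂(volume : Measure E4).toSphere with hCP
      have hCP0 : 0 ≤ CP := integral_nonneg fun α => abs_nonneg _
      have hup : ∀ r : ℝ, 0 < r → |g r| ≤ CP * lfEval ν (timeSpace (r / Real.sqrt 2) 0) := fun r hr =>
        moment_le_axis hshell hinv heq P hr
      have hs2 : 0 < Real.sqrt 2 := Real.sqrt_pos.2 (by norm_num)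
      -- `CP > 0`, else `c ≤ 0`
      have hCPpos : 0 < CP := by
        refine lt_of_le_of_ne hCP0 fun h0 => ?_
        set r : ℝ := min r₀ 1 / 2 with hr
        have hrpos : 0 < r := by positivity
        have hrr₀ : r < r₀ := by
          have : min r₀ 1 ≤ r₀ := min_le_left _ _
          rw [hr]; linarith
        have h1 := hlow r hrpos hrr₀
        have h2 := hup r hrpos
        rw [← h0, zero_mul] at h2
        have h3 : r ^ (L + 2) * |g r| ≤ 0 := by
          have : |g r| = 0 := le_antisymm h2 (abs_nonneg _)
          rw [this, mul_zero]
        linarith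
      refine ⟨c / (16 * CP), by positivity, min r₀ 1 / Real.sqrt 2, by positivity, fun t ht htt₀ => ?_⟩
      -- read the lower bound at `r = √2 t < min(r₀, 1)`
      set r : ℝ := Real.sqrt 2 * t with hr
      have hrpos : 0 < r := by positivity
      have hrlt : r < min r₀ 1 := by
        have := (lt_div_iff₀ hs2).1 htt₀
        rw [hr, mul_comm]
        exact this
      have hrr₀ : r < r₀ := lt_of_lt_of_le hrlt (min_le_left _ _)
      have hr1 : r ≤ 1 := (lt_of_lt_of_le hrlt (min_le_right _ _)).le
      have hrt : r / Real.sqrt 2 = t := by rw [hr]; field_simp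
      have h1 := hlow r hrpos hrr₀
      have h2 := hup r hrpos
      rw [hrt] at h2
      have hL8 : r ^ (L + 2) ≤ r ^ 8 := pow_le_pow_of_le_one hrpos.le hr1 (by omega)
      have hLt : 0 ≤ lfEval ν (timeSpace t 0) := axis_nonneg ht
      have hsq8 : Real.sqrt 2 ^ 8 = 16 := by
        rw [show (8 : ℕ) = 2 * 4 from rfl, pow_mul, Real.sq_sqrt (by norm_num : (0 : ℝ) ≤ 2)]
        norm_num
      have hr8 : r ^ 8 = 16 * t ^ 8 := by rw [hr, mul_pow, hsq8]
      have key : c ≤ (t ^ 8 * lfEval ν (timeSpace t 0)) * (16 * CP) :=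
        calc c ≤ r ^ (L + 2) * |g r| := h1
          _ ≤ r ^ 8 * |g r| := mul_le_mul_of_nonneg_right hL8 (abs_nonneg _)
          _ ≤ r ^ 8 * (CP * lfEval ν (timeSpace t 0)) := mul_le_mul_of_nonneg_left h2 (pow_nonneg hrpos.le _)
          _ = (t ^ 8 * lfEval ν (timeSpace t 0)) * (16 * CP) := by rw [hr8]; ring
      rwa [div_le_iff₀ (by positivity : (0 : ℝ) < 16 * CP)]

end Summit.QuantumFields.YangMills.Theorems.F4SubCurvatureDoorSingleShellDichotomyRegistered

end
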